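import Mathlib
import Summits.ValiantsHypothesis.ValiantsHypothesis.Theorems.BarrierLeverDefinableDcEquationsMethodWalls
import Summits.ValiantsHypothesis.ValiantsHypothesis.Theorems.BarrierLeverDefinableEquationsPartialDerivativeWallAllOrdersWall

/-!
# Route BarrierLever — support item `DefinableDcEquations` (stmt-8746): the ALL-ORDERS
# shifted-partials wall holds on the DETERMINANTAL slices too (val-np-p5 g13)

Item 8746 asks for level-`a` Boolean-sum equations of the classes
`𝒟𝒞_m(n) = {f ∈ ℂ[x_1..x_n] : deg f ≤ n, dc(f) ≤ m(n)}` for a SUPER-QUASI-POLYNOMIAL threshold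
`m` (`∀ C ∃ n₀ ∀ n ≥ n₀, 2^{C (log₂ n + 1)²} ≤ m(n)`).  Every such slice eventually swallows
`SmallCircuits ℂ n 2` (`DcSliceWalls.smallCircuits_subset_dcSlice`, val-np-p5 g10, from the
proved `DcSliceCoversVP`), so the method wall #1c of the crux
(`PartialDerivativeWall.no_shiftedRankMethod_smallCircuits_allOrders`, val-np-p5 g13: for every
FIXED order `k ≥ 1` and shift `τ`, the cheap polynomial `W_{k,τ+k} = Σ_{j<k} (Σ_i x_i^{τ+k+j+1})^k`
attains the universal ceiling of the order-`k` shift-`τ` shifted-partials measure inside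
`SmallCircuits ℂ n 2` once `n ≥ max(k(τ+2k), (2k+2)²)`) transfers verbatim:

* `sp_sublevel_eq_univ_of_dcSlice_allOrders`: for every admissible `m`, every `k ≥ 1` and `τ`,
  eventually in `n`, an order-`k` shift-`τ` threshold set `{g : rank g_{(k,·)[τ]} < r}` containing
  `𝒟𝒞_m(n)` is everything;
* `no_shiftedRankMethod_dcSlice_allOrders`: eventually no such threshold separates `𝒟𝒞_m(n)`
  from any polynomial;
* `distinguisher_eq_zero_of_spRankSublevel_dcSlice`: FSV form — a polynomial in the
  `N = C(2n,n)` coefficient variables cutting out such a threshold set and vanishing on `𝒟𝒞_m(n)`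
  is the zero polynomial (any level, Boolean sums or not).

Reading: with g10's transfer of the shift-`0` / full-rank / product-depth walls, the rank-4
support item is, like the crux, out of reach of the shifted-partials method at EVERY fixed cell;
its intended witnesses (highest-weight vectors of `I(Δ(det_m))`) are of a different nature.
What this is NOT: nothing on the item's truth (OPEN; the dc axis of the tree stands at
`m(n) = n + Θ(a·n/log n)`, val-np-p5 g0–g2) or on `VP ≠ VNP`.  No definitions, no named facts,
standard axioms.  Refs: Bürgisser–Clausen–Shokrollahi 1997 Thm. 21.36 (VSBR/dc);
Forbes–Shpilka–Volk 2018 Def. 1 / Cor. 5; Gesmundo–Landsberg 2019 Thm. 4.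
-/

-- `Summit.ValiantsHypothesis.ValiantsHypothesis.…` repeats a component by the D-0017 layout
-- (single-conjunct summit), which the `dupNamespace` linter flags; the name is mandated.
set_option linter.dupNamespace false

noncomputable section

namespace Summit.ValiantsHypothesis.ValiantsHypothesis.Theorems.BarrierLeverDefinableEquations

open MvPolynomial
open Literature.Computability.AlgebraicComplexity hiding IsSyntacticallyMultilinear smCircuitSize
open Literature.Barriers.ValiantsHypothesis
open scoped BigOperators

namespace DcSliceWalls

/-! ## §5 (continued from `…MethodWalls.lean`): the all-orders shifted-partials wall on the slices -/

/-- The side conditions of the all-orders wall hold from `n₁(k,τ) = max(k(τ+2k), (2k+2)²)` on.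
[folklore] -/
theorem allOrders_side_conditions {k τ n : ℕ} (hk : 1 ≤ k)
    (hn : max (k * (τ + 2 * k)) ((2 * k + 2) * (2 * k + 2)) ≤ n) :
    6 ≤ n ∧ k * (τ + 2 * k) ≤ n ∧ 2 * k * (Nat.log 2 n + 1) ≤ n := by
  have h1 : k * (τ + 2 * k) ≤ n := le_trans (le_max_left _ _) hn
  have h2 : (2 * k + 2) * (2 * k + 2) ≤ n := le_trans (le_max_right _ _) hn
  exact ⟨le_trans (by nlinarith) h2, h1, PartialDerivativeWall.two_mul_mul_log_succ_le hk h2⟩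

/-- **All-orders SP wall on the determinantal slices.**  For every admissible threshold `m`,
every order `k ≥ 1` and shift `τ`, eventually in `n`: an order-`k` shift-`τ` shifted-partials
threshold set `{g : rank g_{(k,·)[τ]} < r}` containing the slice `{deg ≤ n, dc ≤ m(n)}` is
everything. [cite: GesmundoLandsberg2017, Thm. 4] -/
theorem sp_sublevel_eq_univ_of_dcSlice_allOrders (m : ℕ → ℕ)
    (hm : ∀ C : ℕ, ∃ n₀ : ℕ, ∀ n ≥ n₀, 2 ^ (C * (Nat.log 2 n + 1) ^ 2) ≤ m n) {k : ℕ} (hk : 1 ≤ k)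
    (τ : ℕ) :
    ∃ n₀ : ℕ, ∀ n ≥ n₀, ∀ r : ℕ,
      {f : MvPolynomial (Fin n) ℂ | f.totalDegree ≤ n ∧ determinantalComplexity f ≤ m n} ⊆
        {g : MvPolynomial (Fin n) ℂ | shiftedPartialsRank ℂ k τ g < r} →
      {g : MvPolynomial (Fin n) ℂ | shiftedPartialsRank ℂ k τ g < r} = Set.univ := by
  obtain ⟨n₀, hn₀⟩ := smallCircuits_subset_dcSlice m hm 2
  refine ⟨max n₀ (max (k * (τ + 2 * k)) ((2 * k + 2) * (2 * k + 2))), fun n hn r h => ?_⟩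
  obtain ⟨h6, hcell, hcost⟩ := allOrders_side_conditions hk (le_trans (le_max_right _ _) hn)
  refine PartialDerivativeWall.sublevel_eq_univ_of_smallCircuits_allOrders (b := 2) (e := τ + k)
    le_rfl h6 hk le_rfl (by rw [show τ + k + k = τ + 2 * k by ring]; exact hcell) hcost ?_
  exact fun f hf => h (hn₀ n (le_trans (le_max_left _ _) hn) hf)

/-- **No order-`k` shift-`τ` shifted-partials method against the determinantal slices**: for
every admissible `m`, `k ≥ 1`, `τ`, eventually in `n`, there is no threshold `r` with
`rank f_{(k,·)[τ]} < r` on `{deg ≤ n, dc ≤ m(n)}` and `rank g_{(k,·)[τ]} ≥ r` for some polynomial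
`g`. [cite: ForbesShpilkaVolk2018, Cor. 5] -/
theorem no_shiftedRankMethod_dcSlice_allOrders (m : ℕ → ℕ)
    (hm : ∀ C : ℕ, ∃ n₀ : ℕ, ∀ n ≥ n₀, 2 ^ (C * (Nat.log 2 n + 1) ^ 2) ≤ m n) {k : ℕ} (hk : 1 ≤ k)
    (τ : ℕ) :
    ∃ n₀ : ℕ, ∀ n ≥ n₀, ¬ ∃ r : ℕ,
      (∀ f : MvPolynomial (Fin n) ℂ, f.totalDegree ≤ n → determinantalComplexity f ≤ m n →
        shiftedPartialsRank ℂ k τ f < r) ∧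
      ∃ g : MvPolynomial (Fin n) ℂ, r ≤ shiftedPartialsRank ℂ k τ g := by
  obtain ⟨n₀, hn₀⟩ := sp_sublevel_eq_univ_of_dcSlice_allOrders m hm hk τ
  refine ⟨n₀, fun n hn => ?_⟩
  rintro ⟨r, hcls, g, hr⟩
  have huniv := hn₀ n hn r fun f hf => hcls f hf.1 hf.2
  exact absurd (Set.eq_univ_iff_forall.mp huniv g) (not_lt.2 hr)

/-- FSV form: for every admissible `m`, `k ≥ 1`, `τ`, eventually in `n`, a polynomial `D` in the
coefficient variables whose zero set on degree-`≤ n` coefficient vectors is an order-`k` shift-`τ`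
shifted-partials threshold set and which vanishes on `{deg ≤ n, dc ≤ m(n)}` is the ZERO
polynomial — so it is no FSV natural proof against the slice, at any level, with or without
Boolean variables. [cite: ForbesShpilkaVolk2018, Def. 1] -/
theorem distinguisher_eq_zero_of_spRankSublevel_dcSlice (m : ℕ → ℕ)
    (hm : ∀ C : ℕ, ∃ n₀ : ℕ, ∀ n ≥ n₀, 2 ^ (C * (Nat.log 2 n + 1) ^ 2) ≤ m n) {k : ℕ} (hk : 1 ≤ k)
    (τ : ℕ) :
    ∃ n₀ : ℕ, ∀ n ≥ n₀, ∀ (r : ℕ) (D : MvPolynomial (degLEMonomials n) ℂ),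
      (∀ f : MvPolynomial (Fin n) ℂ, f.totalDegree ≤ n →
        (eval (coeffVector (degLEMonomials n) f) D = 0 ↔ shiftedPartialsRank ℂ k τ f < r)) →
      (∀ f : MvPolynomial (Fin n) ℂ, f.totalDegree ≤ n → determinantalComplexity f ≤ m n →
        eval (coeffVector (degLEMonomials n) f) D = 0) →
      D = 0 := by
  obtain ⟨n₀, hn₀⟩ := smallCircuits_subset_dcSlice m hm 2
  refine ⟨max n₀ (max (k * (τ + 2 * k)) ((2 * k + 2) * (2 * k + 2))), fun n hn r D hD hvan => ?_⟩
  obtain ⟨h6, hcell, hcost⟩ := allOrders_side_conditions hk (le_trans (le_max_right _ _) hn)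
  refine PartialDerivativeWall.distinguisher_eq_zero_of_spRankSublevel (b := 2) (e := τ + k)
    le_rfl h6 hk le_rfl (by rw [show τ + k + k = τ + 2 * k by ring]; exact hcell) hcost D hD ?_
  intro f hf
  obtain ⟨hdeg, hdc⟩ := hn₀ n (le_trans (le_max_left _ _) hn) hf
  exact hvan f hdeg hdc

end DcSliceWalls

end Summit.ValiantsHypothesis.ValiantsHypothesis.Theorems.BarrierLeverDefinableEquations
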